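import Summits.BirchSwinnertonDyer.BirchSwinnertonDyer.Theorems.KatoDescentPotSupersingularASideCountOfZetaLineOrthIndex
import Literature.NumberTheory.EllipticCurves.Kato2004.ZetaLineLocalIndex
import HarnessLib

/-!
# Preliminaries for the re-key of crux M (planner TARGET R265, T2): powers of `p` (orders of `p`-primary components and of finite modules over
# `ℤ_p`-algebras) and «a class whose zeta line has a local index at `p` is not torsion»
# (route `KatoDescentPotSupersingular` / `…Tame…`, crux M = stmt-BirchSwinnertonDyer-19196; route-free helper)

Seat `bsd-potss-rkm` g21 (prover; cell `bsd-potss`), item stmt-BirchSwinnertonDyer-19196 (`--supports … --as helper`; closes nothing).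
HONEST FRAMING: BSD is not proved by any of this; nothing is booked; theorems only (no definition, no named fact).

* `natCard_eq_prime_pow_of_forall_pow_smul_eq_zero`, `natCard_primaryComponent_eq_prime_pow`, `exists_prime_pow_smul_eq_zero_of_finite`,
  `natCard_eq_prime_pow_of_finite_module` — every factor of Kato's level-`0` count is a power of `p`;
* `not_isOfFinAddOrder_of_zetaLineOrthIndexAt` — `Kato2004.ZetaLineOrthIndexAt W p y₀ e` forces `y₀` to have infinite order (Kato Thm. 14.5 (2):
  at a level `p^k > ord(y₀)·p^e` the class `ord(y₀)·y₀ = 0` pairs to zero with every local Kummer class).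

References: K. Kato, Astérisque 295 (2004), Thm. 14.5 (2) (p. 236), Prop. 14.16 (2) (pp. 244–245) [Kato2004Asterisque]; J. H. Silverman, *AEC*
VII.3, VIII.6 [SilvermanAEC2009]; J.-P. Serre, *Local Fields* I §3 [SerreLocalFields1979].
-/

-- the summit and its single problem are both named `BirchSwinnertonDyer` (registry layout D-0017)
set_option linter.dupNamespace false
set_option autoImplicit false

noncomputable section

open scoped Classical ContRepresentation NumberField TensorProduct
open CategoryTheory Function Field NumberField IsDedekindDomain WeierstrassCurve CongruenceSubgroup
open Literature.NumberTheory.EllipticCurves Literature.NumberTheory.GaloisRepresentations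
  Literature.NumberTheory.GaloisRepresentations.DiscreteGaloisModule Literature.NumberTheory.GaloisCohomology
open Literature.NumberTheory.EllipticCurves.Kato2004 Literature.NumberTheory.EllipticCurves.Kato2004.EulerSystemValues
open Literature.NumberTheory.EllipticCurves.IwasawaAlgebra Rat.HeightOneSpectrum
open Summit.BirchSwinnertonDyer.Rank1Residual.X11b.Levels Summit.BirchSwinnertonDyer.Rank1Residual.X11b.LocBridge
  Summit.BirchSwinnertonDyer.Rank1Residual.X11b.AcSelmer
open Summit.BirchSwinnertonDyer.BirchSwinnertonDyer.Theorems.ASideJunction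
open Summit.BirchSwinnertonDyer.BirchSwinnertonDyer.Theorems.KatoFiniteLevelCount

namespace Summit.BirchSwinnertonDyer.BirchSwinnertonDyer.Theorems.MemberHullZetaInputsOfCore

/-! ## §1 Powers of `p` -/

section PPow

variable (p : ℕ) [hp : Fact p.Prime]

/-- A finite additive group in which every element is killed by a power of `p` has order a power of `p` (Cauchy).
[cite: SilvermanAEC2009, VII.3 and VIII.6 (the torsion subgroup)] -/
theorem natCard_eq_prime_pow_of_forall_pow_smul_eq_zero {H : Type*} [AddCommGroup H] [Finite H]
    (h : ∀ x : H, ∃ k : ℕ, p ^ k • x = 0) : ∃ m : ℕ, Nat.card H = p ^ m := by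
  have hcard0 : Nat.card H ≠ 0 := Nat.card_pos.ne'
  have hprime : ∀ {d : ℕ}, d.Prime → d ∣ Nat.card H → d = p := by
    intro d hd hdvd
    haveI : Fact d.Prime := ⟨hd⟩
    obtain ⟨x, hx⟩ := exists_prime_addOrderOf_dvd_card' (G := H) d hdvd
    obtain ⟨k, hk⟩ := h x
    have hdk : addOrderOf x ∣ p ^ k := addOrderOf_dvd_of_nsmul_eq_zero hk
    rw [hx] at hdk
    exact (Nat.prime_dvd_prime_iff_eq hd hp.out).mp (hd.dvd_of_dvd_pow hdk)
  exact ⟨_, Nat.eq_prime_pow_of_unique_prime_dvd hcard0 hprime⟩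

/-- The `p`-primary component of an additive group, when finite, has order a power of `p`. [cite: SilvermanAEC2009, VII.3 and VIII.6] -/
theorem natCard_primaryComponent_eq_prime_pow {G : Type*} [AddCommGroup G] [Finite (AddCommGroup.primaryComponent G p)] :
    ∃ m : ℕ, Nat.card (AddCommGroup.primaryComponent G p) = p ^ m :=
  natCard_eq_prime_pow_of_forall_pow_smul_eq_zero p fun x => by
    obtain ⟨k, hk⟩ := (AddCommGroup.mem_primaryComponent (G := G) (p := p)).mp x.2
    exact ⟨k, Subtype.ext (by rw [AddSubmonoidClass.coe_nsmul, hk]; rfl)⟩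

/-- In a finite module over a `ℤ_p`-algebra every element is killed by a power of `p` (its order is `p^a·u` with `u` a unit of `ℤ_p`).
[cite: SerreLocalFields1979, Ch. I §3] -/
theorem exists_prime_pow_smul_eq_zero_of_finite {R : Type*} [CommRing R] [Algebra ℤ_[p] R] {M : Type*} [AddCommGroup M] [Module R M]
    [Finite M] (x : M) : ∃ k : ℕ, p ^ k • x = 0 := by
  have hm0 : addOrderOf x ≠ 0 := (addOrderOf_pos_iff.mpr (isOfFinAddOrder_of_finite x)).ne'
  obtain ⟨a, u, hu, hmu⟩ := Nat.exists_eq_pow_mul_and_not_dvd hm0 p hp.out.ne_one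
  refine ⟨a, ?_⟩
  have hunit : IsUnit ((u : ℤ_[p])) := by
    rw [PadicInt.isUnit_iff, PadicInt.norm_natCast_eq_one_iff]
    exact (hp.out.coprime_iff_not_dvd).mpr hu
  have hunitR : IsUnit ((u : R)) := by simpa using hunit.map (algebraMap ℤ_[p] R)
  have hmx : (u : R) • (p ^ a • x) = 0 := by
    rw [← Nat.cast_smul_eq_nsmul R (p ^ a), smul_smul, ← Nat.cast_mul, mul_comm, ← hmu, Nat.cast_smul_eq_nsmul,
      addOrderOf_nsmul_eq_zero]
  exact (hunitR.smul_left_cancel).mp (by rw [hmx, smul_zero])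

/-- A finite module over a `ℤ_p`-algebra has order a power of `p`. [cite: SerreLocalFields1979, Ch. I §3] -/
theorem natCard_eq_prime_pow_of_finite_module (R : Type*) [CommRing R] [Algebra ℤ_[p] R] (M : Type*) [AddCommGroup M] [Module R M]
    [Finite M] : ∃ m : ℕ, Nat.card M = p ^ m :=
  natCard_eq_prime_pow_of_forall_pow_smul_eq_zero p fun x => exists_prime_pow_smul_eq_zero_of_finite p (R := R) x

omit hp in
/-- `p^a ≤ p^b ↔ a ≤ b` packaged for products: if `p^A ≤ p^B` with `1 < p` then `A ≤ B`. [folklore] -/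
private theorem le_of_pow_le_pow' {a b : ℕ} (hp1 : 1 < p) (h : p ^ a ≤ p ^ b) : a ≤ b :=
  (Nat.pow_le_pow_iff_right hp1).mp h

end PPow

/-! ## §2 A class with a zeta-line index at `p` is not torsion -/

section NonTorsion

variable (W : WeierstrassCurve ℚ) [W.IsElliptic] (p : ℕ) [Fact p.Prime] [ContinuousSMul ℤ_[p] (W.tateModule p)]

/-- **`ZetaLineOrthIndexAt W p y₀ e` forces `y₀` to have infinite order** (given one Poitou–Tate family and one Weil datum to instantiate the
predicate, from `poitouTate_selmerStructure_duality ℚ` and the PROVED `exists_weilPairing_holds`): at a level `k` with `p^k > ord(y₀)·p^e` the class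
`ord(y₀) · y₀ = 0` pairs to zero with everything, so the predicate would give `p^k ∣ ord(y₀)·p^e`.  (Kato Thm. 14.5 (2): the zeta class is not torsion.)
[cite: Kato2004Asterisque, Thm. 14.5 (2) (p. 236)] -/
theorem not_isOfFinAddOrder_of_zetaLineOrthIndexAt (hPT : poitouTate_selmerStructure_duality ℚ) {y₀ : H1 (tateRep W p) ⊤} {e : ℕ}
    (h : ZetaLineOrthIndexAt W p y₀ e) : ¬ IsOfFinAddOrder y₀ := by
  have hp : p.Prime := Fact.out
  intro hfin
  obtain ⟨k₁, hk⟩ := h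
  have hm0 : 0 < addOrderOf y₀ := hfin.addOrderOf_pos
  obtain ⟨k, hk₁, hkm⟩ : ∃ k : ℕ, k₁ ≤ k ∧ addOrderOf y₀ + e ≤ k ∧ True := ⟨k₁ + addOrderOf y₀ + e, by omega, by omega, trivial⟩
  haveI := neZero_pow p 0; haveI := neZero_pow p k
  haveI : Finite (geomTorsion W ((p ^ k : ℕ) : ℤ)) := finite_geomTorsion_pow W p k
  have hpk2 : 2 ≤ p ^ k := le_trans hp.two_le (Nat.le_self_pow (by omega) p)
  obtain ⟨inv, hperf, hsum, -, -⟩ := hPT (p ^ 0 * p ^ k)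
  obtain ⟨ε, hμ, hadd₁, hadd₂, halt, hnondeg, hgal⟩ := (W.exists_weilPairing_holds (p ^ 0 * p ^ k))
    (le_trans hpk2 (Nat.le_mul_of_pos_left _ (pow_pos hp.pos 0))) (Nat.cast_ne_zero.mpr (NeZero.ne (p ^ 0 * p ^ k)))
  have hzero : (addOrderOf y₀ : ℤ) • y₀ = 0 := by rw [natCast_zsmul, addOrderOf_nsmul_eq_zero]
  -- the composite `f_k` as ONE additive map, so that `f_k(0) = 0` is `map_zero`
  let F : H1 (tateRep W p) ⊤ →+
      galoisCohomology (((W.torsionGaloisModule ((p ^ k : ℕ) : ℤ)).tateDual (p ^ 0 * p ^ k)).toLocal (Sum.inr (primePlace p))) 1 :=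
    ((galoisCohomology.localization ((W.torsionGaloisModule ((p ^ k : ℕ) : ℤ)).tateDual (p ^ 0 * p ^ k)) (Sum.inr (primePlace p)) 1).comp
      (galoisCohomology.map (pairingDualIntertwining
        (ρ₁ := W.torsionGaloisModule ((p ^ k : ℕ) : ℤ)) (ρ₂ := W.torsionGaloisModule ((p ^ k : ℕ) : ℤ))
        (B := descendHom W (p ^ 0) (p ^ k) ε hμ hadd₁ hadd₂)
        (descendHom_smul W (p ^ 0) (p ^ k) ε hμ hadd₁ hadd₂ hgal)) 1)).comp
      (((galoisCohomology.map (W.torsionInclusion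
          (show ((p : ℤ) ^ k) ∣ ((p ^ k : ℕ) : ℤ) from ⟨1, (Nat.cast_pow p k).trans (mul_one _).symm⟩)) 1).comp
        (ofTopSubgroup (W.torsionGaloisModule ((p : ℤ) ^ k)).toTopRep 1).hom.toLinearMap.toAddMonoidHom).comp (reduceH1Pk W p k ⊤))
  have hdiv : ((p ^ k : ℕ) : ℤ) ∣ (addOrderOf y₀ : ℤ) * p ^ e :=
    hk k hk₁ 0 inv hsum hperf ε hμ hadd₁ hadd₂ hgal halt hnondeg (addOrderOf y₀ : ℤ) (fun x _ => by
      change localTatePairingZMod _ _ _ _ x (F ((addOrderOf y₀ : ℤ) • y₀)) = 0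
      rw [hzero, map_zero, map_zero])
  have hdiv' : p ^ k ∣ addOrderOf y₀ * p ^ e := by exact_mod_cast hdiv
  have hlt : addOrderOf y₀ * p ^ e < p ^ k :=
    calc addOrderOf y₀ * p ^ e < 2 ^ addOrderOf y₀ * p ^ e :=
          Nat.mul_lt_mul_of_pos_right (Nat.lt_two_pow_self) (pow_pos hp.pos e)
      _ ≤ p ^ addOrderOf y₀ * p ^ e := Nat.mul_le_mul_right _ (Nat.pow_le_pow_left hp.two_le _)
      _ = p ^ (addOrderOf y₀ + e) := (pow_add p _ e).symm
      _ ≤ p ^ k := Nat.pow_le_pow_right hp.pos hkm.1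
  exact absurd (Nat.le_of_dvd (Nat.mul_pos hm0 (pow_pos hp.pos e)) hdiv') (not_le.mpr hlt)

end NonTorsion

end Summit.BirchSwinnertonDyer.BirchSwinnertonDyer.Theorems.MemberHullZetaInputsOfCore

end
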